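import Summits.BirchSwinnertonDyer.BirchSwinnertonDyer.Theorems.PrintCf2SplitBadTwoLayerNormCharIdeal
import Literature.NumberTheory.EllipticCurves.IwasawaSelmerDualUniquenessProofs
import HarnessLib

/-!
# The Selmer dual read over `Γ^{pⁿ}`: `SelmerDualData W κ (γ^{pⁿ})` is the `layerHom`-restriction of
# `SelmerDualData W κ γ`, hence `char_Λ X(E/K_∞ ; γ^{pⁿ}) = N_{Λ/Λ_n}(char_Λ X(E/K_∞ ; γ))`

Cell `bsd-print-cf2`, EXTRA WIDTH seat `bsd-line-cf2-p1-w3` g6, planner brick **B10** (RULING (af)(3)),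
file 4 (the `SelmerDualData` instance of the generic file 1), for crux `PrintCf2.SplitBadTwoRankOneOfFacts`
(stmt-BirchSwinnertonDyer-20368). THEOREMS ONLY (no `def`, no named fact, no `sorry`); Theses-free;
`--supports` the crux as a helper. BSD is not proved by any of this; no summit statement is proved here.

For ONE `ℤ_p`-extension `κ` of a number field `K` (`K_∞ = K̄^{ker κ}`), ONE curve `W/K` and `γ ∈ Γ_K`,
the tree's hypothesis structure `W.SelmerDualData κ γ` (Greenberg's `X_E(K_∞) = Hom(Sel_{p^∞}(E/K_∞), ℚ_p/ℤ_p)`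
with `T` acting as `conj_γ − 1`) makes sense for EVERY `γ`, in particular for `γ^{pⁿ}` — the SAME Selmer
group read as a module over the Iwasawa algebra of `Γ^{pⁿ} = Gal(K_∞/K_n)` written in its own variable
(`1 + T ↔ γ^{pⁿ}`), i.e. «`X_E(K_∞)` over `K_n`».
* `SelmerDualData.toDual_one_add_X_pow_smul` — `(1+T)^k` acts as `conj_{γ^k}` (from the two axioms
  `toDual_T_smul`, `conjH1_mul`).
* **`SelmerDualData.exists_semilinear_pow`** — for `D : W.SelmerDualData κ γ` and ANY
  `D' : W.SelmerDualData κ (γ^{pⁿ})` there is a BIJECTIVE `layerHom p n`-SEMILINEAR `ψ : D'.X → D.X`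
  commuting with the identifications with `Hom(Sel_∞, ℚ/ℤ)`: restricting `D`'s action along
  `layerHom p n : T ↦ (1+T)^{pⁿ} − 1` gives a datum at `γ^{pⁿ}`, unique up to isomorphism by the tree's
  `SelmerDualData.exists_linearEquiv` (the `Λ`-action is forced, `IwasawaSelmerDualUniquenessProofs`).
* **`SelmerDualData.charIdeal_eq_span_layerNorm_of_pow`** — with file 1: if `D.X` is finitely generated
  torsion with `D.charIdeal = (f)`, then `D'.X` is finitely generated torsion and
  **`D'.charIdeal = (layerNorm p n f)`**; `…_map_…`: the same after `PowerSeries.map J`.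
Base change of the FIELD (`Sel(E/M·K_∞)` for a finite `M/K` inside `K_∞`, e.g. the habitat `M = K₀(√2)`,
first layer of `K₀^{cyc}`) is NOT done here: it needs the identification of `H¹(Gal(K̄/K_∞), E[p^∞])` computed
in `Γ_M` and in `Γ_K` (Shapiro-free, same group) — the `-w2`/`ty2` lane.

References: R. Greenberg, LNM 1716 (1999), §1 (PDF p. 60: `X_E(F_∞)` as a `Λ`-module; `Γ_n`)
[GreenbergLNM1716]; L. C. Washington, *Introduction to Cyclotomic Fields*, §13.2 [Washington1997].
-/

noncomputable section

set_option linter.dupNamespace false -- D-0017: single-problem summit, `…BirchSwinnertonDyer.BirchSwinnertonDyer…` repeats a namespace by design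

open scoped Classical

namespace Summit.BirchSwinnertonDyer.BirchSwinnertonDyer.Theorems.PrintCf2.LayerNormCharIdeal

open Literature.NumberTheory.EllipticCurves WeierstrassCurve
  Summit.BirchSwinnertonDyer.Rank1Residual.X1.LayerAlgebra

universe u

variable {K : Type u} [Field K] [NumberField K] {W : WeierstrassCurve K} {p : ℕ} [Fact p.Prime]
  {κ : ZpExtension K p} {γ : Field.absoluteGaloisGroup K}

/-- `Sel_{p^∞}(E/K_∞)` is stable under `conj_σ` for every `σ ∈ Γ_K` (tree
`map_conjH1_selmerGroupOver_le_holds`). [cite: GreenbergLNM1716, §1 (after Conj. 1.3)] -/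
theorem conjH1_mem_selmerInfty (σ : Field.absoluteGaloisGroup K) (s : W.selmerInfty κ) :
    W.conjH1 p κ.kerSubgroup σ s ∈ W.selmerInfty κ :=
  W.map_conjH1_selmerGroupOver_le_holds p κ.kerSubgroup σ ⟨s, s.2, rfl⟩

/-- **`(1 + T)^k` acts as `conj_{γ^k}`** on any Pontryagin-dual datum at `γ`:
`toDual ((1+T)^k • x) (s) = toDual x (conj_{γ^k} s)` (induction: `toDual_T_smul` says `1 + T ↦ conj_γ`,
and `conj_γ ∘ conj_{γ^k} = conj_{γ^{k+1}}` by `conjH1_mul`). [cite: GreenbergLNM1716, §1 (after Conj. 1.3)] -/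
theorem SelmerDualData.toDual_one_add_X_pow_smul (D : W.SelmerDualData κ γ) (k : ℕ) (x : D.X)
    (s : W.selmerInfty κ) :
    D.toDual (((1 + PowerSeries.X : IwasawaAlgebra p) ^ k) • x) s =
      D.toDual x ⟨W.conjH1 p κ.kerSubgroup (γ ^ k) s, conjH1_mem_selmerInfty (γ ^ k) s⟩ := by
  have hstep : ∀ (y : D.X) (t : W.selmerInfty κ),
      D.toDual (((1 + PowerSeries.X : IwasawaAlgebra p)) • y) t =
        D.toDual y ⟨W.conjH1 p κ.kerSubgroup γ t, D.conj_mem t t.2⟩ := fun y t => by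
    rw [add_smul, one_smul, map_add, AddMonoidHom.add_apply, D.toDual_T_smul, add_sub_cancel]
  induction k generalizing s with
  | zero =>
    have hs : (⟨W.conjH1 p κ.kerSubgroup (γ ^ 0) s, conjH1_mem_selmerInfty (γ ^ 0) s⟩ : W.selmerInfty κ) = s :=
      Subtype.ext (by
        change W.conjH1 p κ.kerSubgroup (γ ^ 0) (s : W.subgroupH1 p κ.kerSubgroup) = s
        rw [pow_zero, W.conjH1_one_holds p κ.kerSubgroup]
        rfl)
    rw [hs, pow_zero, one_smul]
  | succ k ih =>
    rw [pow_succ', mul_smul, hstep, ih]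
    have hst : (⟨W.conjH1 p κ.kerSubgroup (γ ^ k) (W.conjH1 p κ.kerSubgroup γ s),
        conjH1_mem_selmerInfty (γ ^ k) ⟨_, D.conj_mem s s.2⟩⟩ : W.selmerInfty κ) =
        ⟨W.conjH1 p κ.kerSubgroup (γ ^ (k + 1)) s, conjH1_mem_selmerInfty (γ ^ (k + 1)) s⟩ :=
      Subtype.ext (by
        change W.conjH1 p κ.kerSubgroup (γ ^ k) (W.conjH1 p κ.kerSubgroup γ s) =
          W.conjH1 p κ.kerSubgroup (γ ^ (k + 1)) s
        rw [pow_succ, W.conjH1_mul_holds p κ.kerSubgroup (γ ^ k) γ, AddMonoidHom.comp_apply])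
    exact congrArg (D.toDual x) hst

/-- **The Selmer dual at `γ^{pⁿ}` is the `layerHom`-restriction of the Selmer dual at `γ`.** For
`D : W.SelmerDualData κ γ` and ANY `D' : W.SelmerDualData κ (γ^{pⁿ})` there is a bijective
`layerHom p n`-semilinear `ψ : D'.X → D.X` (`ψ (a • x) = a(ω_n) • ψ x`) with `toDual (ψ x) = toDual' x`:
`D.X` with `Λ` acting through `layerHom p n` IS a datum at `γ^{pⁿ}` (`T ↦ (1+T)^{pⁿ} − 1 ↦ conj_{γ^{pⁿ}} − 1`
by `toDual_one_add_X_pow_smul`; constants unchanged), and data at `γ^{pⁿ}` are unique up to `Λ`-isomorphism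
(tree `SelmerDualData.exists_linearEquiv`). [cite: GreenbergLNM1716, §1 (after Conj. 1.3)]
[cite: Washington1997, §13.2] -/
theorem SelmerDualData.exists_semilinear_pow (D : W.SelmerDualData κ γ) (n : ℕ)
    (D' : W.SelmerDualData κ (γ ^ p ^ n)) :
    ∃ ψ : D'.X →ₛₗ[layerHom p n] D.X, Function.Bijective ψ ∧ ∀ x, D.toDual (ψ x) = D'.toDual x := by
  let Dn : W.SelmerDualData κ (γ ^ p ^ n) :=
    { X := D.X
      module := Module.compHom D.X (layerHom p n)
      conj_mem := fun s hs => conjH1_mem_selmerInfty (γ ^ p ^ n) ⟨s, hs⟩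
      toDual := D.toDual
      bijective := D.bijective
      toDual_T_smul := fun x s => by
        change D.toDual ((layerHom p n PowerSeries.X) • x) s = _
        rw [layerHom_X, sub_smul, one_smul, map_sub, AddMonoidHom.sub_apply,
          SelmerDualData.toDual_one_add_X_pow_smul D (p ^ n) x s]
      toDual_C_smul := fun c x s k hk => by
        change D.toDual ((layerHom p n (PowerSeries.C c)) • x) s = _
        rw [layerHom_C]
        exact D.toDual_C_smul c x s k hk }
  obtain ⟨e, he⟩ := SelmerDualData.exists_linearEquiv D' Dn
  exact ⟨{ toFun := e, map_add' := fun x y => e.map_add x y, map_smul' := fun a x => e.map_smul a x },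
    e.bijective, he⟩

/-- **B10 for the Selmer dual: `char_Λ X(E/K_∞ ; γ^{pⁿ}) = (N_n f)` where `char_Λ X(E/K_∞ ; γ) = (f)`.**
If the datum `D` at `γ` has `D.X` finitely generated torsion with `D.charIdeal = (f)`, then for ANY datum
`D'` at `γ^{pⁿ}`: `D'.X` is finitely generated, torsion, and `D'.charIdeal = (layerNorm p n f)` (file 1
`finite_isTorsion_charIdeal_of_semilinear` along `exists_semilinear_pow`). [cite: Washington1997, §13.2]
[cite: GreenbergLNM1716, §1 (after Conj. 1.3)] -/
theorem SelmerDualData.charIdeal_eq_span_layerNorm_of_pow (D : W.SelmerDualData κ γ)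
    [Module.Finite (IwasawaAlgebra p) D.X] (hD : D.IsTorsion) (n : ℕ)
    (D' : W.SelmerDualData κ (γ ^ p ^ n)) {f : IwasawaAlgebra p}
    (hf : D.charIdeal = Ideal.span {f}) :
    Module.Finite (IwasawaAlgebra p) D'.X ∧ D'.IsTorsion ∧ D'.charIdeal = Ideal.span {layerNorm p n f} := by
  obtain ⟨ψ, hψ, -⟩ := SelmerDualData.exists_semilinear_pow D n D'
  obtain ⟨hF, hT, hC⟩ := finite_isTorsion_charIdeal_of_semilinear D.X hD D'.X ψ hψ
  exact ⟨hF, hT, hC f hf⟩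

/-- The same in the mapped currency of the tree's main-conjecture statements: for any `J : ℤ_p → 𝒪`,
`(D'.charIdeal).map (PowerSeries.map J) = ((N_n f).map J)` and
`((N_n f).map J)((1+T)^{pⁿ} − 1) = (N_n f)(ω_n).map J`. [cite: Washington1997, §13.2] -/
theorem SelmerDualData.charIdeal_map_eq_span_of_pow (D : W.SelmerDualData κ γ)
    [Module.Finite (IwasawaAlgebra p) D.X] (hD : D.IsTorsion) (n : ℕ)
    (D' : W.SelmerDualData κ (γ ^ p ^ n)) {f : IwasawaAlgebra p}
    (hf : D.charIdeal = Ideal.span {f}) {𝒪 : Type*} [CommRing 𝒪] (J : ℤ_[p] →+* 𝒪) :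
    (D'.charIdeal).map (PowerSeries.map J) = Ideal.span {PowerSeries.map J (layerNorm p n f)} ∧
      (PowerSeries.map J (layerNorm p n f)).subst ((1 + PowerSeries.X : PowerSeries 𝒪) ^ p ^ n - 1) =
        PowerSeries.map J (layerHom p n (layerNorm p n f)) := by
  obtain ⟨ψ, hψ, -⟩ := SelmerDualData.exists_semilinear_pow D n D'
  exact charIdeal_map_eq_span_of_semilinear (X := D.X) (Y := D'.X) hD ψ hψ hf J

end Summit.BirchSwinnertonDyer.BirchSwinnertonDyer.Theorems.PrintCf2.LayerNormCharIdeal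

end
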